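import Literature.MathematicalPhysics.QuantumFieldTheory.Balaban1983to89.B4Lower18
import Literature.MathematicalPhysics.QuantumFieldTheory.Balaban1983to89.B4

/-!
# `Balaban1983to89.B4Prop31Zero` — B4's «Proposition 3.1′ of [2]»: the lower bound (1.22) for the quadratic form of
`Δ^{(k)}(Ω, A) = a_kI − a_k²Q_k(A)G_k(Ω,A)Q_k^*(A)` (1.14), in the case `A = 0`, for EVERY finite `Ω^{(k)} ⊂ ℤ^{d+1}`
(«Ω^{(k)} is an arbitrary subset of Z^d»), every mesh `η = 1/n`, every `a_k > 0` and `m² ≥ 0`, with the explicit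
constant `γ₀ = min(a_k/(8(d+1) + 2m²), 1/8)` and NO error term; and the DAG leaf `B4.Prop31Printed` (leaf `b4`,
conjunct 3 of `B4.LeafB4`; surge node T01.3) PROVED for the concrete family of all zero-field instances
(`prop31Printed_zeroField`).  HYPOTHESIS-FREE (a sibling of `B4BoxCov237` §3–§4, which did (2.37) = the massless BOX
case of the same Schur complement, and of `B4Lower18`, whose region operator `fineOpR` — the operator of (1.6) on a
union of blocks — and its inverse are USED; no existing module is touched; nothing of B4 at `A ≠ 0` is asserted).

Source under audit (cell pub-balaban): T. Bałaban, *Regularity and decay of lattice Green's functions*, Commun. Math.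
Phys. **89** (1983) 571–597 [`Balaban1983RegularityDecay`, "B4"], p. 572 [PDF 2] (1.3)–(1.6), p. 573 [PDF 3] (1.14),
p. 574 [PDF 4] «Proposition 3.1′ of [2]» (1.21)–(1.22), p. 589 [PDF 19] – p. 590 [PDF 20] §4 (4.1)–(4.7) (journal
page = PDF page + 570; renders `b2b-balaban-ref1/pages/1983-cmp89-regularity-decay/1983-cmp89-regularity-decay-p00N-x2.png`,
read as images; cell transcript `b2b-balaban-b04/transcript-B4.md`).

## WHAT IS PRINTED (verbatim; `≦` of the print written `≤`)

p. 572 [PDF 2]: *"⟨φ, (−Δ^{η,N}_{A,Ω})φ⟩ = Σ_{b⊂Ω} η^d |(D^η_Aφ)(b)|² = Σ_{b⊂Ω} η^d |η^{−1}(U(A_b)φ(b₊) − φ(b₋))|²,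
φ : Ω → R^N"* (1.3), where the *"summation is over the set of all bonds b = ⟨b₋,b₊⟩ with end-points b₋, b₊ in Ω"*;
*"(Q_k(A)φ)(y) = Σ_{x∈B^k(y)} η^d U(A(Γ^{(k)}_{y,x})) φ(x), y ∈ Z^d"* (1.4); *"P_k(A) = Q_k^*(A) Q_k(A)"* (1.5);
*"G_k(Ω, A) = (−Δ^{η,N}_{A,Ω} + m² + aP_k(A))^{−1}"* (1.6), *"where m² ≥ 0 and a is a positive constant close to 1."*

p. 573 [PDF 3]: *"Here Δ^{(k)}(Ω,A) is an operator of the effective Gaussian action after k renormalization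
transformations and can be defined by
Δ^{(k)}(Ω,A) = a_k I − a_k² Q_k(A) G_k(Ω,A) Q_k^*(A),   (1.14)
where a_k is a constant proportional to a."*

p. 574 [PDF 4]: *"The last theorem we have to prove is the bound from below for the operator Δ^{(k)}(Ω,A)."*
**Proposition 3.1′ of [2].** *"Let Ω be a sum of unit blocks (i.e. Ω^{(k)} is an arbitrary subset of Z^d) and let A
satisfies the condition
|(∂^η_μ A)(x)| ≤ O(1) p(e)   (p(e) = a₀(1 + log e^{−1})^p),   (1.21)
then there exists a positive constant γ₀ depending on d only, such that for e sufficiently small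
⟨φ, Δ^{(k)}(Ω,A)φ⟩ ≥ γ₀ ( Σ_{⟨x,x'⟩⊂Ω^{(k)}} |U(A(⟨x,x'⟩))φ(x') − φ(x)|² + m² Σ_{x∈Ω^{(k)}} |φ(x)|² )
  − O(1) e^{2−α} Σ_{x∈Ω^{(k)}} |φ(x)|²   (1.22)
for arbitrary α > 0 and a constant O(1) depending on α and the other constants, but independent of Ω, k, A, and for
an arbitrary function φ."*  *"This theorem implies (3.29) of [2]."*

p. 589 [PDF 19], §4 *"Proof of the Lower Bound for the Quadratic Form Δ^{(k)} (Proposition 3.1')"*: *"We will estimate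
the quadratic form on the left hand side of (1.18) in several ways, finally getting all the terms on the right hand
side."* … *"(the left hand side of (1.18)) ≥ Σ_{x∈Ω^{(k)}} (a_km²/(a_k+m²))|φ(x)|² ≥ (a_k/(a_k+O(1)))Σ_{x∈Ω^{(k)}}m²|φ(x)|²,
if m² ≤ O(1). Thus a part of the inequality (1.18) is proved."* (4.4) … *"Now let us consider the set of all positively
oriented bonds ⟨x,x'⟩ ⊂ Ω^{(k)}."* … p. 590 [PDF 20]: *"Then γ₀ = ½min{γ₀'/(2d), a_k/(a_k+O(1))}."*  [«(1.18)» in §4 denotes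
(1.22): the in-text references to §1 displays are low by four throughout (cell transcript, GLOBAL ERRATUM).]

## WHAT THIS FILE CERTIFIES (kernel-checked, no hypotheses; the lineage is USED, not re-proved)

Throughout `A = 0` (so `U ≡ 1`), spatial dimension `d + 1 =: D` (the paper's `d`), mesh `η = 1/n` with ANY `n ≥ 1` (the
paper's `n = L^k`), everything in LATTICE UNITS as in `B4Lower18` / `B4BoxCov237`: the unit-lattice set `Ω^{(k)}` ↔ a
finite `Ω : Finset (Fin (d+1) → ℤ)`; the region `Ω = ⋃_{y∈Ω^{(k)}} B^k(y)` («Let Ω be a sum of unit blocks») ↔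
`B4Lower18.fineDom n Ω` (the fine points `x` with `blk n x ∈ Ω`); the operator of (1.6) on it ↔ the matrix
`B4Lower18.fineOpR n a m² (fineDom n Ω)`, whose quadratic form is the printed one (`B4Lower18.fineOpR_form`) and which
is invertible for `a > 0`, `m² ≥ 0` (`B4Lower18.fineOpR_isUnit`); `G_k(Ω, 0)` ↔ its inverse.

* (§2, `indR`, `KeffR`, `KeffR_isSymm`, `KeffR_form_eq`) `Δ^{(k)}(Ω, 0)` of (1.14) as the real symmetric matrix on
  `Ω^{(k)}`: `KeffR n a m² Ω = a·1 − (a²/n^D)·indR·(fineOpR n a m² (fineDom n Ω))⁻¹·indRᵀ`, `indR y x = [blk n x = y]`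
  the block indicator (`n^{-D}·indR` = `Q_k(0)`, `indRᵀ` = `Q_k^*(0)` under the dictionary below).
* (§2, `KeffR_form_eq_energy`) the ENERGY IDENTITY (Schur complement): with `N = n^D`, `T = fineOpR`, `G = T⁻¹`,
  `g⋆ = a·G·indRᵀφ` (`gStarR`): `⟨φ, Δ^{(k)}(Ω,0)φ⟩ = a‖φ − N⁻¹indR g⋆‖² + N⁻¹·(⟨g⋆, Tg⋆⟩ − (a/N)‖indR g⋆‖²)`, and
  (§3, `fineEnergyR_eq`, from `B4Lower18.fineOpR_form`) `⟨g, Tg⟩ − (a/N)‖indR g‖² = (n²/2)Σ_xΣ_{x′∼x}(g x − g x′)² +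
  m²‖g‖²` (the kinetic part (1.3) plus the mass; the averaging term of (1.6) cancels); `blockAvg_sq_le` (Jensen):
  `‖N⁻¹indR g‖² ≤ N⁻¹‖g‖²`.
* (§4, `pathPt_mem`, `dirS_blockSum_le`, `dirS_blockAvg_le`) the AVERAGING INEQUALITY for an ARBITRARY finite
  `Ω^{(k)}`: the unit bond form over `Ω^{(k)}` of the block sums of `h` is `≤ 2·n^{D+2}·`(the fine bond form of `h` over
  `η^{-1}Ω`) — the straight path of `n` unit steps from `B^k(y)` to `B^k(y + e_μ)` stays inside `B^k(y) ∪ B^k(y+e_μ) ⊂ Ω`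
  (no convexity of `Ω` is needed), telescoping + Cauchy–Schwarz, each fine bond serving at most two unit bonds.
* (§5, `KeffR_form_ge`) **(1.22) AT `A = 0`, EXPLICIT CONSTANT**: for every `d`, `n ≥ 1`, `a > 0`, `m² ≥ 0`, every
  finite `Ω^{(k)} ⊂ ℤ^D` and every `φ : Ω^{(k)} → ℝ`,
  `min(a/(8(d+1) + 2m²), 1/8)·(Σ_{⟨y,y′⟩⊂Ω^{(k)}}(φ(y′) − φ(y))² + m²Σ_{y∈Ω^{(k)}}φ(y)²) ≤ ⟨φ, Δ^{(k)}(Ω,0)φ⟩`;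
  `KeffR_form_le`: `⟨φ, Δ^{(k)}(Ω,0)φ⟩ ≤ a‖φ‖²`; `ineq122_A0`: the printed quantifier order over a parameter window
  `a ≥ a₋ > 0`, `0 ≤ m² ≤ m²₊` — ONE `γ₀ = min(a₋/(8(d+1) + 2m²₊), 1/8)` for every mesh, every `Ω^{(k)}`, every `φ`.
* (§6, `ZeroIdx`, `zeroFieldForms`, `prop31Printed_zeroField`) the DAG LEAF: `B4.Prop31Printed (zeroFieldForms d a₋ m²₊)`
  — the verbatim-typed (1.21)–(1.22) of `B4.lean` HOLDS on the concrete carriers of all zero-field instances (index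
  `ZeroIdx`: mesh `n`, `Ω^{(k)}`, `a_k ≥ a₋`, `0 ≤ m² ≤ m²₊`, the charge `e`, the number `N` of real field components;
  `Cfg = Ω^{(k)} → ℝ^N`), with `γ₀` as above, threshold `e₁ = 1` and error constant `C(α) = 0`.

Mechanism (for the referee).  The paper's §4 route — (4.1)–(4.4) for the mass part, then the `2d` matchings `B_i`,
Neumann decoupling into two-block sets `Δ(x,x′)` (4.5)–(4.7), the expansion in `A′` and Lemma II.2.4, (4.8)–(4.22) — is
NOT reproduced; at `A = 0` an elementary global argument gives (1.22) directly.  Write `F = ⟨φ, Δ^{(k)}φ⟩ = aA + N⁻¹B`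
by the energy identity (`A = ‖φ − Q_kg⋆‖²`, `Q_k = N⁻¹indR` the block average, `B = (n²/2)U(g⋆) + m²‖g⋆‖² ≥ 0`).  The
unit bond form `E` over `Ω^{(k)}`: `E(φ) ≤ 2E(φ − Q_kg⋆) + 2E(Q_kg⋆) ≤ 8(d+1)A + 8N⁻¹·(n²/2)U` (each unit site lies in
`≤ 2(d+1)` bonds, `dirS_extS_le_norm`; the averaging inequality, `dirS_blockAvg_le`); the mass term:
`m²‖φ‖² ≤ 2m²A + 2m²‖Q_kg⋆‖² ≤ 2m²A + 2m²N⁻¹‖g⋆‖²` (Jensen).  Hence `E + m²‖φ‖² ≤ (8(d+1) + 2m²)A + 8N⁻¹B ≤ γ₀⁻¹F`.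

## DICTIONARY (folklore; each line is used only through the kernel-checked identities named)

* paper's dimension `d` ↔ our `d + 1 =: D`; `η = L^{-k}` ↔ `1/n`; `x ∈ B^k(y)` ↔ `blk n x = y` (1.1)
  (`B4Green242Bridge.blk`, `B4BoxCov237.blk_finePt`); `Ω^{(k)} = Ω ∩ Z^d` ↔ the finite label set `Ω`,
  `Ω = ⋃_{y∈Ω^{(k)}}B^k(y)` ↔ `fineDom n Ω`.
* `A = 0`: `U(A(⟨x,x′⟩)) = 1`, `U(A(Γ)) = 1`; every operator of (1.3)–(1.6), (1.14) acts componentwise, so the real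
  scalar theorem (`KeffR_form_ge`) is each component of the printed `φ : Ω^{(k)} → R^N` and `zeroFieldForms` sums it
  over `Fin N` (a `ℂ^N`- or Lie-algebra-valued `φ` is a real field with more components).
* inner products: on `Ω ⊂ ηℤ^D`, `⟨φ,ψ⟩ = Σ_x η^Dφ(x)ψ(x)` (the convention of (1.3)–(1.5)); on the unit lattice `Ω^{(k)}`
  the counting one (the sums of (1.22)).  Then `Q_k(0)φ = N⁻¹·indR φ` (block average, `N = n^D = η^{-D}`), `Q_k^*(0)ψ =
  indRᵀψ` (piecewise-constant extension; the adjoint for these two inner products), the operator of (1.6) acts by the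
  matrix `fineOpR` and `G_k(Ω,0)` by `(fineOpR)⁻¹` (no `η`-factors; `B4Lower18`, DICTIONARY), so `Δ^{(k)}(Ω,0)` of (1.14)
  acts on `ψ : Ω^{(k)} → ℝ` by `aψ − a²N⁻¹·indR((fineOpR)⁻¹(indRᵀψ)) = (KeffR n a m² Ω).mulVec ψ` and
  `⟨φ, Δ^{(k)}(Ω,0)φ⟩ = φ ⬝ᵥ (KeffR n a m² Ω).mulVec φ` — the same dictionary as `B4BoxCov237.Keff` ((2.37), boxes,
  `m²` arbitrary there too), of which `KeffR` is the general-region twin (`B4Lower18.fineOpR_boxDom` identifies the fine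
  operators on a box; the entrywise identification of the two `Δ^{(k)}` matrices on a box is not needed and not derived).
* the sums of (1.22): `Σ_{⟨x,x′⟩⊂Ω^{(k)}}` over the nearest-neighbour unit bonds with both end-points in `Ω^{(k)}`, each
  bond once («the set of all positively oriented bonds ⟨x,x'⟩ ⊂ Ω^{(k)}», p. 589) ↔ `dirS Ω (extS Ω φ)` (`extS` = zero
  extension; `dirS` = `B4BoxCov237.dirBox` on boxes, `dirS_boxDom`); `Σ_{x∈Ω^{(k)}}|φ(x)|²` ↔ `φ ⬝ᵥ φ`.  (Were the bond
  sum read over ordered pairs, it doubles and `γ₀` halves: `dirS_extS_le_pairSum`.)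

## HONEST SCOPE

* `A = 0` ONLY: (1.21) is then void, «for e sufficiently small» is not needed (`e` does not enter the operators), and
  the printed error term `−O(1)e^{2−α}Σ|φ(x)|²` is dropped (`C(α) = 0` in `B4.Prop31Printed`).  NOTHING is claimed about
  `A ≠ 0`, which is the content of the paper's §4 (4.7)–(4.22) and of [2] Lemma 2.4 (cell census G-B4-06/07/08).
* `γ₀`: the print says «depending on d only»; ours, `min(a_k/(8(d+1) + 2m²), 1/8)`, depends on `a_k` and on (an upper
  bound for) `m²` — exactly as the printed proof's own constant does («Then γ₀ = ½min{γ₀'/(2d), a_k/(a_k+O(1))}»,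
  «if m² ≤ O(1)»; cell DIVERGENCE D-b04.3, `B4.prop31_gamma0`); over a window `a_k ≥ a₋`, `m² ≤ m²₊` it is one constant
  (`ineq122_A0`).  No attempt at a sharp constant.
* `Ω^{(k)}` FINITE (a `Finset`): the paper's regions (unions of blocks in `T_η`, or the `Λ_k` of [2] (3.29)) are finite
  in every use; an infinite `Ω^{(k)} ⊂ Z^d` would need (1.6) on `ℓ²`, not typed in this lineage.  The torus variant is
  not typed here.  Lattice units / counting bases as in `B4Lower18`, `B4BoxCov237`.
* `B4.Prop31Printed` quantifies over an abstract family `fam : I → B4.FormSetting`; this file discharges it for ONE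
  concrete family (all zero-field instances).  It does not — and cannot — discharge the abstract leaf hypothesis
  `B4.Prop31Printed famF` of `DagBinding` / `DagDischarged` for an arbitrary `famF`; it is offered to the DAG carver as
  the leaf-`b4` / conjunct-3 / `A = 0` instance (cf. `DagDischarged.famOfLattice`).

Value = kernel certificate of a published inequality in a special case ((1.22) at `A = 0`, every finite `Ω^{(k)}`,
explicit `γ₀`) and the first PROVED instance of the typed leaf `B4.Prop31Printed`; NOT summit progress (the YangMills /
QuantumFields statements are untouched).
-/

namespace Literature.MathematicalPhysics.QuantumFieldTheory.Balaban1983to89.B4Prop31Zero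

open Finset Matrix
open Literature.MathematicalPhysics.QuantumFieldTheory.Balaban1983to89.B4Reflection242
open Literature.MathematicalPhysics.QuantumFieldTheory.Balaban1983to89.B4Green242Bridge
open Literature.MathematicalPhysics.QuantumFieldTheory.Balaban1983to89.B4BoxCov237
open Literature.MathematicalPhysics.QuantumFieldTheory.Balaban1983to89.B4Lower18
open B4Green244 (finePt)

noncomputable section

variable {d : ℕ}

/-! ## §1  Functions on a finite set of sites: zero extension and the oriented bond form -/

/-- zero extension of a function on a finite set of sites `S ⊂ ℤ^{d+1}` to the whole lattice
(`B4BoxCov237.extB` is the case `S` = a box, `extS_boxDom`). [folklore] -/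
def extS (S : Finset (Fin (d + 1) → ℤ)) (v : ↥S → ℝ) : (Fin (d + 1) → ℤ) → ℝ :=
  fun z => if hz : z ∈ S then v ⟨z, hz⟩ else 0

/-- on a box, `extS` is the lineage's `extB`. [folklore] -/
theorem extS_boxDom (N : Fin (d + 1) → ℕ) (v : ↥(boxDom N) → ℝ) : extS (boxDom N) v = extB N v := rfl

/-- the zero extension agrees with the function on the set. [folklore] -/
theorem extS_of_mem {S : Finset (Fin (d + 1) → ℤ)} (v : ↥S → ℝ) {z : Fin (d + 1) → ℤ} (hz : z ∈ S) :
    extS S v z = v ⟨z, hz⟩ := by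
  simp [extS, hz]

/-- the zero extension at a point of the set. [folklore] -/
@[simp] theorem extS_coe {S : Finset (Fin (d + 1) → ℤ)} (v : ↥S → ℝ) (x : ↥S) : extS S v x.1 = v x := by
  rw [extS_of_mem v x.2]

/-- the zero extension is additive. [folklore] -/
theorem extS_add {S : Finset (Fin (d + 1) → ℤ)} (u v : ↥S → ℝ) : extS S (u + v) = extS S u + extS S v := by
  funext z
  by_cases hz : z ∈ S
  · simp [extS_of_mem _ hz]
  · simp [extS, hz]

/-- the zero extension commutes with scalars. [folklore] -/
theorem extS_smul {S : Finset (Fin (d + 1) → ℤ)} (c : ℝ) (v : ↥S → ℝ) : extS S (c • v) = c • extS S v := by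
  funext z
  by_cases hz : z ∈ S
  · simp [extS_of_mem _ hz]
  · simp [extS, hz]

/-- the `μ`-bonds `⟨z, z + e_μ⟩` with both endpoints in `S`, as the set of their sources
(`B4BoxCov237.bondSet` is the case of a box). [folklore] -/
def bset (S : Finset (Fin (d + 1) → ℤ)) (μ : Fin (d + 1)) : Finset (Fin (d + 1) → ℤ) :=
  S.filter (fun z => z + uvec μ ∈ S)

/-- **THE ORIENTED BOND FORM OF A FINITE SET OF SITES**: `Σ_μ Σ_{z, z+e_μ ∈ S} (h(z + e_μ) − h z)²` — each
nearest-neighbour bond `⟨x, x′⟩ ⊂ S` exactly once (the positively oriented bonds), the shape of the sums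
«Σ_{⟨x,x′⟩⊂Ω^{(k)}}» of (1.22) at `U ≡ 1` (`B4BoxCov237.dirBox` is the case of a box, `dirS_boxDom`).
[cite: Balaban1983RegularityDecay, p. 574 (1.22), dictionary] [folklore] -/
def dirS (S : Finset (Fin (d + 1) → ℤ)) (h : (Fin (d + 1) → ℤ) → ℝ) : ℝ :=
  ∑ μ, ∑ z ∈ bset S μ, (h (z + uvec μ) - h z) ^ 2

/-- on a box, `dirS` is the lineage's `dirBox`. [folklore] -/
theorem dirS_boxDom (N : Fin (d + 1) → ℕ) (h : (Fin (d + 1) → ℤ) → ℝ) : dirS (boxDom N) h = dirBox N h := rfl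

/-- the bond form is nonnegative. [folklore] -/
theorem dirS_nonneg (S : Finset (Fin (d + 1) → ℤ)) (h : (Fin (d + 1) → ℤ) → ℝ) : 0 ≤ dirS S h :=
  Finset.sum_nonneg fun _ _ => Finset.sum_nonneg fun _ _ => sq_nonneg _

/-- the bond form only depends on the values on the set. [folklore] -/
theorem dirS_congr {S : Finset (Fin (d + 1) → ℤ)} {h₁ h₂ : (Fin (d + 1) → ℤ) → ℝ} (H : ∀ z ∈ S, h₁ z = h₂ z) :
    dirS S h₁ = dirS S h₂ := by
  refine Finset.sum_congr rfl fun μ _ => Finset.sum_congr rfl fun z hz => ?_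
  unfold bset at hz
  rw [Finset.mem_filter] at hz
  rw [H z hz.1, H _ hz.2]

/-- the bond form is quadratic under scaling. [folklore] -/
theorem dirS_smul (S : Finset (Fin (d + 1) → ℤ)) (c : ℝ) (h : (Fin (d + 1) → ℤ) → ℝ) :
    dirS S (c • h) = c ^ 2 * dirS S h := by
  unfold dirS
  rw [Finset.mul_sum]
  refine Finset.sum_congr rfl fun μ _ => ?_
  rw [Finset.mul_sum]
  refine Finset.sum_congr rfl fun z _ => ?_
  simp only [Pi.smul_apply, smul_eq_mul]
  ring

/-- the parallelogram bound `E(h₁ + h₂) ≤ 2E(h₁) + 2E(h₂)`. [folklore] -/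
theorem dirS_add_le (S : Finset (Fin (d + 1) → ℤ)) (h₁ h₂ : (Fin (d + 1) → ℤ) → ℝ) :
    dirS S (h₁ + h₂) ≤ 2 * dirS S h₁ + 2 * dirS S h₂ := by
  unfold dirS
  rw [Finset.mul_sum, Finset.mul_sum, ← Finset.sum_add_distrib]
  refine Finset.sum_le_sum fun μ _ => ?_
  rw [Finset.mul_sum, Finset.mul_sum, ← Finset.sum_add_distrib]
  refine Finset.sum_le_sum fun z _ => ?_
  simp only [Pi.add_apply]
  nlinarith [sq_nonneg ((h₁ (z + uvec μ) - h₁ z) - (h₂ (z + uvec μ) - h₂ z))]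

/-- the squared norm through the zero extension. [folklore] -/
theorem sum_extS_sq {S : Finset (Fin (d + 1) → ℤ)} (v : ↥S → ℝ) : ∑ z ∈ S, extS S v z ^ 2 = v ⬝ᵥ v := by
  rw [← Finset.sum_coe_sort S]
  unfold dotProduct
  refine Finset.sum_congr rfl fun x _ => ?_
  rw [extS_coe, sq]

/-- `E_S(v) ≤ 4(d+1)‖v‖²` (each site lies in at most `2(d+1)` bonds). [folklore] -/
theorem dirS_extS_le_norm {S : Finset (Fin (d + 1) → ℤ)} (v : ↥S → ℝ) :
    dirS S (extS S v) ≤ 4 * (d + 1) * (v ⬝ᵥ v) := by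
  classical
  have hμ : ∀ μ : Fin (d + 1),
      ∑ z ∈ bset S μ, (extS S v (z + uvec μ) - extS S v z) ^ 2 ≤ 4 * (v ⬝ᵥ v) := by
    intro μ
    have h1 : ∑ z ∈ bset S μ, extS S v z ^ 2 ≤ v ⬝ᵥ v := by
      rw [← sum_extS_sq v]
      exact Finset.sum_le_sum_of_subset_of_nonneg (Finset.filter_subset _ _) fun _ _ _ => sq_nonneg _
    have h2 : ∑ z ∈ bset S μ, extS S v (z + uvec μ) ^ 2 ≤ v ⬝ᵥ v := by
      have hinj : Set.InjOn (fun z : Fin (d + 1) → ℤ => z + uvec μ) ↑(bset S μ) :=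
        fun _ _ _ _ h => add_right_cancel h
      rw [← Finset.sum_image (f := fun z => extS S v z ^ 2) hinj, ← sum_extS_sq v]
      refine Finset.sum_le_sum_of_subset_of_nonneg ?_ fun _ _ _ => sq_nonneg _
      intro z hz
      obtain ⟨z', hz', rfl⟩ := Finset.mem_image.1 hz
      unfold bset at hz'
      exact (Finset.mem_filter.1 hz').2
    calc ∑ z ∈ bset S μ, (extS S v (z + uvec μ) - extS S v z) ^ 2
        ≤ ∑ z ∈ bset S μ, (2 * extS S v (z + uvec μ) ^ 2 + 2 * extS S v z ^ 2) :=
          Finset.sum_le_sum fun z _ => by nlinarith [sq_nonneg (extS S v (z + uvec μ) + extS S v z)]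
      _ = 2 * ∑ z ∈ bset S μ, extS S v (z + uvec μ) ^ 2 + 2 * ∑ z ∈ bset S μ, extS S v z ^ 2 := by
          rw [Finset.sum_add_distrib, Finset.mul_sum, Finset.mul_sum]
      _ ≤ 4 * (v ⬝ᵥ v) := by linarith
  calc dirS S (extS S v) ≤ ∑ _μ : Fin (d + 1), 4 * (v ⬝ᵥ v) := Finset.sum_le_sum fun μ _ => hμ μ
    _ = 4 * (d + 1) * (v ⬝ᵥ v) := by
        rw [Finset.sum_const, Finset.card_univ, Fintype.card_fin, nsmul_eq_mul]
        push_cast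
        ring

/-- **THE ORIENTED BOND FORM IS DOMINATED BY THE SUM OVER ORDERED NEAREST-NEIGHBOUR PAIRS**:
`E_S(v) ≤ Σ_x Σ_{x′ ∈ S, x′ ∼ x} (v x − v x′)²` (the right side counts every bond twice; it is the shape of the
Dirichlet part of `B4Lower18.fineOpR_form`). [folklore] -/
theorem dirS_extS_le_pairSum {S : Finset (Fin (d + 1) → ℤ)} (v : ↥S → ℝ) :
    dirS S (extS S v) ≤ ∑ x : ↥S, ∑ x' : ↥S, if x'.1 ∈ nbrs x.1 then (v x - v x') ^ 2 else 0 := by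
  classical
  have hL : dirS S (extS S v)
      = ∑ x : ↥S, ∑ μ, if x.1 + uvec μ ∈ S then (extS S v (x.1 + uvec μ) - extS S v x.1) ^ 2 else 0 := by
    unfold dirS bset
    simp only [Finset.sum_filter]
    rw [Finset.sum_comm, ← Finset.sum_coe_sort S]
  rw [hL]
  refine Finset.sum_le_sum fun x _ => ?_
  set f : Fin (d + 1) → ↥S := fun μ => if h : x.1 + uvec μ ∈ S then ⟨x.1 + uvec μ, h⟩ else x with hf
  set P : Finset (Fin (d + 1)) := Finset.univ.filter (fun μ => x.1 + uvec μ ∈ S) with hP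
  have hfP : ∀ μ ∈ P, (f μ).1 = x.1 + uvec μ := by
    intro μ hμ
    have h := (Finset.mem_filter.1 hμ).2
    simp only [hf, dif_pos h]
  have hinj : Set.InjOn f ↑P := by
    intro μ hμ ν hν h
    have h' := congrArg Subtype.val h
    rw [hfP μ hμ, hfP ν hν] at h'
    exact uvec_injective (add_left_cancel h')
  have hsub : P.image f ⊆ Finset.univ.filter (fun x' : ↥S => x'.1 ∈ nbrs x.1) := by
    intro x' hx'
    obtain ⟨μ, hμ, rfl⟩ := Finset.mem_image.1 hx'
    simp only [Finset.mem_filter, Finset.mem_univ, true_and]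
    rw [hfP μ hμ]
    exact mem_nbrs.2 ⟨μ, Or.inl rfl⟩
  calc ∑ μ, (if x.1 + uvec μ ∈ S then (extS S v (x.1 + uvec μ) - extS S v x.1) ^ 2 else 0)
      = ∑ μ ∈ P, (v x - v (f μ)) ^ 2 := by
        rw [hP, Finset.sum_filter]
        refine Finset.sum_congr rfl fun μ _ => ?_
        split_ifs with h
        · rw [extS_of_mem v h, extS_coe]
          simp only [hf, dif_pos h]
          ring
        · rfl
    _ = ∑ x' ∈ P.image f, (v x - v x') ^ 2 := by rw [Finset.sum_image hinj]
    _ ≤ ∑ x' ∈ Finset.univ.filter (fun x' : ↥S => x'.1 ∈ nbrs x.1), (v x - v x') ^ 2 :=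
        Finset.sum_le_sum_of_subset_of_nonneg hsub fun _ _ _ => sq_nonneg _
    _ = ∑ x' : ↥S, if x'.1 ∈ nbrs x.1 then (v x - v x') ^ 2 else 0 := by
        rw [Finset.sum_filter]

/-! ## §2  The fine region over `Ω^{(k)}`: blocks, block sums, and `Δ^{(k)}(Ω, 0)` as a matrix on `Ω^{(k)}` -/

/-- the chart points of a unit label of `Ω` lie in the fine region. [folklore] -/
theorem finePt_mem_fineDom {n : ℕ} (hn : 1 ≤ n) {Ω : Finset (Fin (d + 1) → ℤ)} {y : Fin (d + 1) → ℤ}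
    (hy : y ∈ Ω) (j : Fin (d + 1) → Fin n) : finePt n y j ∈ fineDom n Ω := by
  rw [mem_fineDom hn, blk_finePt hn]
  exact hy

/-- the block labels met by the fine region are exactly `Ω`. [folklore] -/
theorem image_blk_fineDom {n : ℕ} (hn : 1 ≤ n) (Ω : Finset (Fin (d + 1) → ℤ)) :
    (fineDom n Ω).image (blk n) = Ω := by
  ext y
  rw [Finset.mem_image]
  constructor
  · rintro ⟨x, hx, rfl⟩
    exact (mem_fineDom hn).1 hx
  · intro hy
    exact ⟨finePt n y (fun _ => ⟨0, by omega⟩), finePt_mem_fineDom hn hy _, blk_finePt hn y _⟩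

/-- the block over a unit label is the image of its chart. [folklore] -/
theorem filter_blk_eq_imageR {n : ℕ} (hn : 1 ≤ n) (Ω : Finset (Fin (d + 1) → ℤ)) (y : ↥Ω) :
    Finset.univ.filter (fun x : ↥(fineDom n Ω) => blk n x.1 = y.1)
      = Finset.univ.image (fun j : Fin (d + 1) → Fin n =>
          (⟨finePt n y.1 j, finePt_mem_fineDom hn y.2 j⟩ : ↥(fineDom n Ω))) := by
  ext x
  simp only [Finset.mem_filter, Finset.mem_univ, true_and, Finset.mem_image]
  constructor
  · intro h
    obtain ⟨j, hj⟩ := finePt_offset_of_blk hn h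
    exact ⟨j, Subtype.ext hj⟩
  · rintro ⟨j, rfl⟩
    exact blk_finePt hn y.1 j

/-- every block of the fine region has `n^{d+1}` points. [folklore] -/
theorem card_filter_blkR {n : ℕ} (hn : 1 ≤ n) (Ω : Finset (Fin (d + 1) → ℤ)) (y : ↥Ω) :
    (Finset.univ.filter (fun x : ↥(fineDom n Ω) => blk n x.1 = y.1)).card = n ^ (d + 1) := by
  rw [filter_blk_eq_imageR hn Ω y, Finset.card_image_of_injective, Finset.card_univ, Fintype.card_fun,
    Fintype.card_fin, Fintype.card_fin]
  intro j j' h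
  exact finePt_injective n y.1 (congrArg Subtype.val h)

/-- the BLOCK INDICATOR `indR n Ω y x = [blk n x = y]` (unit label `y ∈ Ω^{(k)}`, fine point `x ∈ η^{-1}Ω`): the
matrix of `η^{-(d+1)}Q_k(0)` (block sum, (1.4) at `U ≡ 1`); its transpose is the matrix of `Q_k^*(0)`
(piecewise-constant extension) (`B4BoxCov237.indB` is the case of a box).
[cite: Balaban1983RegularityDecay, p. 572 (1.4), dictionary] [folklore] -/
def indR (n : ℕ) (Ω : Finset (Fin (d + 1) → ℤ)) : Matrix ↥Ω ↥(fineDom n Ω) ℝ :=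
  Matrix.of fun y x => if blk n x.1 = y.1 then 1 else 0

/-- the block sum: `(indR g)(y) = Σ_{x : blk x = y} g x`. [folklore] -/
theorem indR_mulVec (n : ℕ) (Ω : Finset (Fin (d + 1) → ℤ)) (g : ↥(fineDom n Ω) → ℝ) (y : ↥Ω) :
    (indR n Ω).mulVec g y = ∑ x ∈ Finset.univ.filter (fun x : ↥(fineDom n Ω) => blk n x.1 = y.1), g x := by
  rw [Finset.sum_filter]
  unfold Matrix.mulVec dotProduct
  refine Finset.sum_congr rfl fun x _ => ?_
  simp only [indR, Matrix.of_apply]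
  split_ifs <;> simp

/-- the block sum through the chart: `(indR g)(y) = Σ_j g(n·y + j)`. [folklore] -/
theorem indR_mulVec_eq_chartSum {n : ℕ} (hn : 1 ≤ n) (Ω : Finset (Fin (d + 1) → ℤ))
    (g : ↥(fineDom n Ω) → ℝ) (y : ↥Ω) :
    (indR n Ω).mulVec g y = ∑ j : Fin (d + 1) → Fin n, extS (fineDom n Ω) g (finePt n y.1 j) := by
  rw [indR_mulVec, filter_blk_eq_imageR hn Ω y, Finset.sum_image]
  · refine Finset.sum_congr rfl fun j _ => ?_
    rw [extS_of_mem g (finePt_mem_fineDom hn y.2 j)]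
  · intro j _ j' _ h
    exact finePt_injective n y.1 (congrArg Subtype.val h)

/-- **B4 (1.14)'s `Δ^{(k)}(Ω, A)` AT `A = 0`, in lattice units, as a real matrix on `Ω^{(k)}`**:
`Δ^{(k)}(Ω, 0) = a_k I − a_k² Q_k G_k(Ω, 0) Q_k^*` with `G_k(Ω, 0) = (B4Lower18.fineOpR n a_k m² (η^{-1}Ω))⁻¹` the Neumann
Green's function (1.6) of the fine region, `Q_k = n^{-(d+1)}·indR`, `Q_k^* = indRᵀ`:
`a_k·1 − (a_k²/n^{d+1})·indR·G·indRᵀ` (`B4BoxCov237.Keff` is the case `Ω` = a box).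
[cite: Balaban1983RegularityDecay, p. 573 (1.14) with p. 572 (1.6), dictionary] [folklore] -/
def KeffR (n : ℕ) (a m2 : ℝ) (Ω : Finset (Fin (d + 1) → ℤ)) : Matrix ↥Ω ↥Ω ℝ :=
  a • (1 : Matrix ↥Ω ↥Ω ℝ)
    - (a ^ 2 * ((n : ℝ) ^ (d + 1))⁻¹) • (indR n Ω * (fineOpR n a m2 (fineDom n Ω))⁻¹ * (indR n Ω)ᵀ)

/-- `G_k(Ω, 0)` is a symmetric matrix. [folklore] -/
theorem fineOpR_inv_isSymm (n : ℕ) (a m2 : ℝ) (R : Finset (Fin (d + 1) → ℤ)) : ((fineOpR n a m2 R)⁻¹).IsSymm := by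
  unfold Matrix.IsSymm
  rw [Matrix.transpose_nonsing_inv, (fineOpR_isSymm n a m2 R).eq]

/-- `Δ^{(k)}(Ω, 0)` is symmetric. [folklore] -/
theorem KeffR_isSymm (n : ℕ) (a m2 : ℝ) (Ω : Finset (Fin (d + 1) → ℤ)) : (KeffR n a m2 Ω).IsSymm := by
  have hG := fineOpR_inv_isSymm n a m2 (fineDom n Ω)
  unfold Matrix.IsSymm at hG ⊢
  simp only [KeffR, Matrix.transpose_sub, Matrix.transpose_smul, Matrix.transpose_one, Matrix.transpose_mul,
    Matrix.transpose_transpose, hG, Matrix.mul_assoc]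

/-- the form of `Δ^{(k)}(Ω, 0)`: `ψ ⬝ Δψ = a‖ψ‖² − (a²/n^{d+1})·(indRᵀψ) ⬝ G (indRᵀψ)`. [folklore] -/
theorem KeffR_form_eq (n : ℕ) (a m2 : ℝ) (Ω : Finset (Fin (d + 1) → ℤ)) (ψ : ↥Ω → ℝ) :
    ψ ⬝ᵥ (KeffR n a m2 Ω).mulVec ψ
      = a * (ψ ⬝ᵥ ψ) - a ^ 2 * ((n : ℝ) ^ (d + 1))⁻¹ *
          ((indR n Ω)ᵀ.mulVec ψ ⬝ᵥ ((fineOpR n a m2 (fineDom n Ω))⁻¹).mulVec ((indR n Ω)ᵀ.mulVec ψ)) := by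
  rw [KeffR, Matrix.sub_mulVec, Matrix.smul_mulVec, Matrix.one_mulVec, dotProduct_sub, dotProduct_smul,
    smul_eq_mul, Matrix.smul_mulVec, dotProduct_smul, smul_eq_mul, ← Matrix.mulVec_mulVec, ← Matrix.mulVec_mulVec,
    Matrix.dotProduct_mulVec ψ (indR n Ω), ← Matrix.mulVec_transpose]

/-- for `a > 0`, `m² ≥ 0` the operator (1.6) of the fine region is invertible, so `G_k(Ω, 0)` is a genuine inverse
(`B4Lower18.fineOpR_mul_inv`). [folklore] -/
theorem fineOpR_mul_inv_fineDom {n : ℕ} (hn : 1 ≤ n) {a m2 : ℝ} (ha : 0 < a) (hm : 0 ≤ m2)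
    (Ω : Finset (Fin (d + 1) → ℤ)) :
    fineOpR n a m2 (fineDom n Ω) * (fineOpR n a m2 (fineDom n Ω))⁻¹ = 1 :=
  fineOpR_mul_inv hn ha.le (add_pos_of_pos_of_nonneg (lt_min two_pos ha) hm) (fineDom_isBlockUnion hn Ω)

/-- the minimiser `g⋆ = a·G(indRᵀψ)` of the constrained fine energy (`= a_kG_k(Ω,0)Q_k^*φ` up to the factor
`n^{d+1}` of `Q_k^*` versus `indRᵀ`). [folklore] -/
def gStarR (n : ℕ) (a m2 : ℝ) (Ω : Finset (Fin (d + 1) → ℤ)) (ψ : ↥Ω → ℝ) : ↥(fineDom n Ω) → ℝ :=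
  a • ((fineOpR n a m2 (fineDom n Ω))⁻¹).mulVec ((indR n Ω)ᵀ.mulVec ψ)

/-- completing the square: `a‖ψ − N⁻¹·indR g‖² + N⁻¹(g ⬝ Tg − (a/N)‖indR g‖²) = a‖ψ‖² − (2a/N)(indRᵀψ) ⬝ g +
N⁻¹ g ⬝ Tg` (`N = n^{d+1}`, `T = fineOpR`). [folklore] -/
theorem energy_expandR (n : ℕ) (a m2 : ℝ) (Ω : Finset (Fin (d + 1) → ℤ)) (ψ : ↥Ω → ℝ)
    (g : ↥(fineDom n Ω) → ℝ) :
    a * (∑ y, (ψ y - ((n : ℝ) ^ (d + 1))⁻¹ * (indR n Ω).mulVec g y) ^ 2)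
      + ((n : ℝ) ^ (d + 1))⁻¹ * (g ⬝ᵥ (fineOpR n a m2 (fineDom n Ω)).mulVec g
          - a * ((n : ℝ) ^ (d + 1))⁻¹ * ∑ y, (indR n Ω).mulVec g y ^ 2)
      = a * (ψ ⬝ᵥ ψ) - 2 * a * ((n : ℝ) ^ (d + 1))⁻¹ * ((indR n Ω)ᵀ.mulVec ψ ⬝ᵥ g)
        + ((n : ℝ) ^ (d + 1))⁻¹ * (g ⬝ᵥ (fineOpR n a m2 (fineDom n Ω)).mulVec g) := by
  have hcross : (indR n Ω)ᵀ.mulVec ψ ⬝ᵥ g = ∑ y, ψ y * (indR n Ω).mulVec g y := by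
    rw [Matrix.mulVec_transpose, ← Matrix.dotProduct_mulVec]
    rfl
  have hsq : ∑ y, (ψ y - ((n : ℝ) ^ (d + 1))⁻¹ * (indR n Ω).mulVec g y) ^ 2
      = (ψ ⬝ᵥ ψ) - 2 * ((n : ℝ) ^ (d + 1))⁻¹ * (∑ y, ψ y * (indR n Ω).mulVec g y)
        + (((n : ℝ) ^ (d + 1))⁻¹) ^ 2 * ∑ y, (indR n Ω).mulVec g y ^ 2 := by
    unfold dotProduct
    rw [Finset.mul_sum, Finset.mul_sum, ← Finset.sum_sub_distrib, ← Finset.sum_add_distrib]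
    refine Finset.sum_congr rfl fun y _ => ?_
    ring
  rw [hsq, hcross]
  ring

/-- **THE VARIATIONAL VALUE** (energy identity of the Schur complement): `ψ ⬝ Δ^{(k)}(Ω,0)ψ = a‖ψ − Q g⋆‖² +
N⁻¹·(g⋆ ⬝ T g⋆ − (a/N)‖indR g⋆‖²)` with `Q = N⁻¹·indR`, `g⋆ = a G indRᵀψ` (uses only `T·G = 1`): in the paper's
variables `⟨φ, Δ^{(k)}(Ω,0)φ⟩ = a_k‖φ − Q_kφ₀‖² + ⟨φ₀, (−Δ^{η,N}_Ω + m²)φ₀⟩`, `φ₀ = a_kG_k(Ω,0)Q_k^*φ`. [folklore] -/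
theorem KeffR_form_eq_energy {n : ℕ} (hn : 1 ≤ n) {a m2 : ℝ} (ha : 0 < a) (hm : 0 ≤ m2)
    (Ω : Finset (Fin (d + 1) → ℤ)) (ψ : ↥Ω → ℝ) :
    ψ ⬝ᵥ (KeffR n a m2 Ω).mulVec ψ
      = a * (∑ y, (ψ y - ((n : ℝ) ^ (d + 1))⁻¹ * (indR n Ω).mulVec (gStarR n a m2 Ω ψ) y) ^ 2)
        + ((n : ℝ) ^ (d + 1))⁻¹ * (gStarR n a m2 Ω ψ ⬝ᵥ (fineOpR n a m2 (fineDom n Ω)).mulVec (gStarR n a m2 Ω ψ)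
            - a * ((n : ℝ) ^ (d + 1))⁻¹ * ∑ y, (indR n Ω).mulVec (gStarR n a m2 Ω ψ) y ^ 2) := by
  rw [energy_expandR, KeffR_form_eq]
  set T := fineOpR n a m2 (fineDom n Ω)
  set G := (fineOpR n a m2 (fineDom n Ω))⁻¹
  set φ := (indR n Ω)ᵀ.mulVec ψ
  have hT : ∀ v, T.mulVec (G.mulVec v) = v := fun v => by
    rw [Matrix.mulVec_mulVec, fineOpR_mul_inv_fineDom hn ha hm Ω, Matrix.one_mulVec]
  have hg : gStarR n a m2 Ω ψ = a • G.mulVec φ := rfl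
  rw [hg]
  have h1 : a • G.mulVec φ ⬝ᵥ T.mulVec (a • G.mulVec φ) = a * (a * (φ ⬝ᵥ G.mulVec φ)) := by
    rw [Matrix.mulVec_smul, hT, smul_dotProduct, dotProduct_smul, smul_eq_mul, smul_eq_mul, dotProduct_comm]
  have h2 : φ ⬝ᵥ a • G.mulVec φ = a * (φ ⬝ᵥ G.mulVec φ) := by
    rw [dotProduct_smul, smul_eq_mul]
  rw [h1, h2]
  ring

/-! ## §3  The fine energy: `B4Lower18.fineOpR_form` with the block term recognised as `(a/N)‖indR g‖²` -/

/-- the block-sum squares over the labels met by the fine region are the block-sum squares over `Ω`. [folklore] -/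
theorem blockSqR_eq {n : ℕ} (hn : 1 ≤ n) (Ω : Finset (Fin (d + 1) → ℤ)) (g : ↥(fineDom n Ω) → ℝ) :
    ∑ b : ↥((fineDom n Ω).image (blk n)),
        (∑ x ∈ Finset.univ.filter (fun x => rblk n (fineDom n Ω) x = b), g x) ^ 2
      = ∑ y : ↥Ω, (indR n Ω).mulVec g y ^ 2 := by
  set F : (Fin (d + 1) → ℤ) → ℝ := fun β =>
    (∑ x ∈ Finset.univ.filter (fun x : ↥(fineDom n Ω) => blk n x.1 = β), g x) ^ 2 with hF
  have hL : ∀ b : ↥((fineDom n Ω).image (blk n)),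
      (∑ x ∈ Finset.univ.filter (fun x => rblk n (fineDom n Ω) x = b), g x) ^ 2 = F b.1 := by
    intro b
    simp only [hF]
    congr 2
    refine Finset.filter_congr fun x _ => ?_
    simp only [rblk]
    exact Subtype.ext_iff
  have hRt : ∀ y : ↥Ω, (indR n Ω).mulVec g y ^ 2 = F y.1 := by
    intro y
    rw [indR_mulVec]
  rw [Fintype.sum_congr _ _ hL, Fintype.sum_congr _ _ hRt, Finset.sum_coe_sort ((fineDom n Ω).image (blk n)) F,
    Finset.sum_coe_sort Ω F, image_blk_fineDom hn]

/-- **THE FINE ENERGY**: `g ⬝ Tg − (a/N)·Σ_y (indR g)_y² = (n²/2)·Σ_xΣ_{x′ ∼ x}(g x − g x′)² + m²‖g‖²` — the kinetic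
part (1.3) plus the mass term, the averaging term `a‖Q_kφ‖²` of (1.6) having been removed
(`B4Lower18.fineOpR_form`). [cite: Balaban1983RegularityDecay, p. 572 (1.3)–(1.6), dictionary] [folklore] -/
theorem fineEnergyR_eq {n : ℕ} (hn : 1 ≤ n) (a m2 : ℝ) (Ω : Finset (Fin (d + 1) → ℤ))
    (g : ↥(fineDom n Ω) → ℝ) :
    g ⬝ᵥ (fineOpR n a m2 (fineDom n Ω)).mulVec g - a * ((n : ℝ) ^ (d + 1))⁻¹ * ∑ y, (indR n Ω).mulVec g y ^ 2
      = (n : ℝ) ^ 2 / 2 * (∑ x : ↥(fineDom n Ω), ∑ x' : ↥(fineDom n Ω),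
          if x'.1 ∈ nbrs x.1 then (g x - g x') ^ 2 else 0) + m2 * (g ⬝ᵥ g) := by
  rw [fineOpR_form hn (fineDom_isBlockUnion hn Ω) a m2 g, blockSqR_eq hn Ω g]
  ring

/-- **JENSEN ON BLOCKS**: `‖Q_k g‖² = Σ_y (N⁻¹(indR g)_y)² ≤ N⁻¹‖g‖²` (`N = n^{d+1}` points per block, the blocks
partition the fine region). [folklore] -/
theorem blockAvg_sq_le {n : ℕ} (hn : 1 ≤ n) (Ω : Finset (Fin (d + 1) → ℤ)) (g : ↥(fineDom n Ω) → ℝ) :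
    ∑ y : ↥Ω, (((n : ℝ) ^ (d + 1))⁻¹ * (indR n Ω).mulVec g y) ^ 2 ≤ ((n : ℝ) ^ (d + 1))⁻¹ * (g ⬝ᵥ g) := by
  have hn0 : (0 : ℝ) < n := by exact_mod_cast hn
  set N : ℝ := (n : ℝ) ^ (d + 1) with hN
  have hN0 : 0 < N := by positivity
  set lab : ↥(fineDom n Ω) → ↥Ω := fun x => ⟨blk n x.1, (mem_fineDom hn).1 x.2⟩ with hlab
  have hfilter : ∀ y : ↥Ω, Finset.univ.filter (fun x : ↥(fineDom n Ω) => blk n x.1 = y.1)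
      = Finset.univ.filter (fun x => lab x = y) := by
    intro y
    refine Finset.filter_congr fun x _ => ?_
    rw [hlab, Subtype.ext_iff]
  -- per block: Cauchy–Schwarz
  have hy : ∀ y : ↥Ω, (N⁻¹ * (indR n Ω).mulVec g y) ^ 2
      ≤ N⁻¹ * ∑ x ∈ Finset.univ.filter (fun x => lab x = y), g x ^ 2 := by
    intro y
    rw [indR_mulVec, hfilter y]
    have hcs := sq_sum_le_card_mul_sum_sq (s := Finset.univ.filter (fun x => lab x = y)) (f := g)
    have hcard : ((Finset.univ.filter (fun x => lab x = y)).card : ℝ) = N := by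
      rw [← hfilter y, card_filter_blkR hn Ω y]
      push_cast
      rfl
    rw [hcard] at hcs
    have hS0 : 0 ≤ ∑ x ∈ Finset.univ.filter (fun x => lab x = y), g x ^ 2 :=
      Finset.sum_nonneg fun _ _ => sq_nonneg _
    rw [mul_pow]
    calc (N⁻¹) ^ 2 * (∑ x ∈ Finset.univ.filter (fun x => lab x = y), g x) ^ 2
        ≤ (N⁻¹) ^ 2 * (N * ∑ x ∈ Finset.univ.filter (fun x => lab x = y), g x ^ 2) :=
          mul_le_mul_of_nonneg_left hcs (by positivity)
      _ = N⁻¹ * ∑ x ∈ Finset.univ.filter (fun x => lab x = y), g x ^ 2 := by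
          field_simp
  calc ∑ y : ↥Ω, (N⁻¹ * (indR n Ω).mulVec g y) ^ 2
      ≤ ∑ y : ↥Ω, N⁻¹ * ∑ x ∈ Finset.univ.filter (fun x => lab x = y), g x ^ 2 := Finset.sum_le_sum fun y _ => hy y
    _ = N⁻¹ * ∑ x, g x ^ 2 := by
        rw [← Finset.mul_sum, Finset.sum_fiberwise Finset.univ lab (fun x => g x ^ 2)]
    _ = N⁻¹ * (g ⬝ᵥ g) := by
        congr 1
        unfold dotProduct
        exact Finset.sum_congr rfl fun x _ => (sq (g x))

/-! ## §4  The averaging inequality for the fine region over an ARBITRARY finite `Ω^{(k)}` -/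

/-- **BLOCK LABELS ALONG THE PATH**: for an offset `j` and `s ≤ n`, the fine point `n·y + j + s·e_μ` lies in the
block of `y` or in the block of `y + e_μ`. [folklore] -/
theorem nearBlk_pathPt {n : ℕ} (hn : 1 ≤ n) (y : Fin (d + 1) → ℤ) (μ : Fin (d + 1)) (j : Fin (d + 1) → Fin n)
    {s : ℕ} (hs : s ≤ n) : NearBlk n μ y (finePt n y j + (s : ℤ) • uvec μ) := by
  have hn0 : (0 : ℤ) < n := by exact_mod_cast hn
  have hs' : (s : ℤ) ≤ n := by exact_mod_cast hs
  have hs0 : (0 : ℤ) ≤ s := by positivity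
  have hcoord : ∀ i, (finePt n y j + (s : ℤ) • uvec μ) i
      = (n : ℤ) * y i + (((j i : ℕ) : ℤ) + (if i = μ then (s : ℤ) else 0)) := by
    intro i
    simp only [Pi.add_apply, finePt_apply, Pi.smul_apply, smul_eq_mul]
    by_cases hi : i = μ
    · subst hi
      rw [uvec_apply_same, if_pos rfl]
      ring
    · rw [uvec_apply_ne hi, if_neg hi]
      ring
  have hj : ∀ i, (0 : ℤ) ≤ ((j i : ℕ) : ℤ) ∧ ((j i : ℕ) : ℤ) + 1 ≤ n := fun i =>
    ⟨by positivity, by have := (j i).isLt; omega⟩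
  have hq := ediv_eq_zero_or_one hn0 (r := ((j μ : ℕ) : ℤ) + (s : ℤ)) (by have := (hj μ).1; linarith)
    (by have := (hj μ).2; linarith)
  have hblk : ∀ i, blk n (finePt n y j + (s : ℤ) • uvec μ) i
      = y i + (((j i : ℕ) : ℤ) + (if i = μ then (s : ℤ) else 0)) / n := by
    intro i
    simp only [blk]
    rw [hcoord i, add_comm ((n : ℤ) * y i) _, Int.add_mul_ediv_left _ _ hn0.ne', add_comm]
  have hoffdiv : ∀ i, i ≠ μ → (((j i : ℕ) : ℤ) + (if i = μ then (s : ℤ) else 0)) / n = 0 := by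
    intro i hi
    rw [if_neg hi, add_zero]
    exact Int.ediv_eq_zero_of_lt (hj i).1 (by have := (hj i).2; omega)
  unfold NearBlk
  rcases hq with hq | hq
  · left
    funext i
    rw [hblk i]
    by_cases hi : i = μ
    · subst hi; rw [if_pos rfl, hq, add_zero]
    · rw [hoffdiv i hi, add_zero]
  · right
    funext i
    rw [hblk i, Pi.add_apply]
    by_cases hi : i = μ
    · subst hi; rw [if_pos rfl, hq, uvec_apply_same]
    · rw [hoffdiv i hi, uvec_apply_ne hi]

/-- **THE PATH STAYS IN THE FINE REGION**: for a unit bond `⟨y, y + e_μ⟩ ⊂ Ω^{(k)}`, every point `n·y + j + s·e_μ`,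
`s ≤ n`, lies in `η^{-1}Ω` — because its block label is `y` or `y + e_μ` (no convexity of `Ω` is needed). [folklore] -/
theorem pathPt_mem {n : ℕ} (hn : 1 ≤ n) {Ω : Finset (Fin (d + 1) → ℤ)} {y : Fin (d + 1) → ℤ} {μ : Fin (d + 1)}
    (hy : y ∈ Ω) (hy' : y + uvec μ ∈ Ω) (j : Fin (d + 1) → Fin n) {s : ℕ} (hs : s ≤ n) :
    finePt n y j + (s : ℤ) • uvec μ ∈ fineDom n Ω := by
  rw [mem_fineDom hn]
  have h := nearBlk_pathPt hn y μ j hs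
  unfold NearBlk at h
  rcases h with h | h
  · rw [h]; exact hy
  · rw [h]; exact hy'

/-- **THE PATH POINTS** (region version of `B4BoxCov237.pathPt_facts`): for a unit bond `⟨y, y + e_μ⟩ ⊂ Ω^{(k)}`, an
offset `j` and `t < n`, the fine bond `⟨z, z + e_μ⟩`, `z = n·y + j + t·e_μ`, lies in `η^{-1}Ω`, and `z` lies in the
block of `y` or of `y + e_μ`. [folklore] -/
theorem pathPt_factsR {n : ℕ} (hn : 1 ≤ n) {Ω : Finset (Fin (d + 1) → ℤ)} {y : Fin (d + 1) → ℤ} {μ : Fin (d + 1)}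
    (hy : y ∈ Ω) (hy' : y + uvec μ ∈ Ω) (j : Fin (d + 1) → Fin n) {t : ℕ} (ht : t < n) :
    finePt n y j + (t : ℤ) • uvec μ ∈ bset (fineDom n Ω) μ ∧ NearBlk n μ y (finePt n y j + (t : ℤ) • uvec μ) := by
  refine ⟨?_, nearBlk_pathPt hn y μ j ht.le⟩
  unfold bset
  rw [Finset.mem_filter]
  refine ⟨pathPt_mem hn hy hy' j ht.le, ?_⟩
  have h := pathPt_mem hn hy hy' j (Nat.succ_le_of_lt ht)
  have e : finePt n y j + (t : ℤ) • uvec μ + uvec μ = finePt n y j + ((t + 1 : ℕ) : ℤ) • uvec μ := by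
    push_cast
    rw [add_smul, one_smul, add_assoc]
  rw [e]
  exact h

/-- **THE AVERAGING INEQUALITY FOR THE FINE REGION OVER AN ARBITRARY FINITE `Ω^{(k)}`** (region version of
`B4BoxCov237.dirBox_blockSum_le`): the unit bond form over `Ω^{(k)}` of the block sums is at most `2·n^{d+3}` times
the fine bond form over `η^{-1}Ω` (telescoping along the `n` unit steps joining the two blocks — all inside `η^{-1}Ω`
by `pathPt_mem` — Cauchy–Schwarz, and each fine bond serves at most two unit bonds). [folklore] -/
theorem dirS_blockSum_le {n : ℕ} (hn : 1 ≤ n) (Ω : Finset (Fin (d + 1) → ℤ)) (h : (Fin (d + 1) → ℤ) → ℝ) :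
    dirS Ω (fun y => ∑ j : Fin (d + 1) → Fin n, h (finePt n y j))
      ≤ 2 * (n : ℝ) ^ (d + 3) * dirS (fineDom n Ω) h := by
  have hn0 : (0 : ℝ) < n := by exact_mod_cast hn
  -- per unit bond
  have hbond : ∀ μ, ∀ y ∈ bset Ω μ,
      ((∑ j : Fin (d + 1) → Fin n, h (finePt n (y + uvec μ) j)) - ∑ j : Fin (d + 1) → Fin n, h (finePt n y j)) ^ 2
        ≤ (n : ℝ) ^ (d + 3) *
          ∑ z ∈ (bset (fineDom n Ω) μ).filter (fun z => NearBlk n μ y z), (h (z + uvec μ) - h z) ^ 2 := by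
    intro μ y hy
    have hy2 := hy
    unfold bset at hy2
    obtain ⟨hyM, hy'⟩ := Finset.mem_filter.1 hy2
    set S := ∑ z ∈ (bset (fineDom n Ω) μ).filter (fun z => NearBlk n μ y z), (h (z + uvec μ) - h z) ^ 2
      with hS
    have hS0 : 0 ≤ S := Finset.sum_nonneg fun _ _ => sq_nonneg _
    -- telescoping
    have hdiff : (∑ j : Fin (d + 1) → Fin n, h (finePt n (y + uvec μ) j)) - ∑ j : Fin (d + 1) → Fin n, h (finePt n y j)
        = ∑ j : Fin (d + 1) → Fin n, ∑ t ∈ Finset.range n,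
            (h (finePt n y j + (t : ℤ) • uvec μ + uvec μ) - h (finePt n y j + (t : ℤ) • uvec μ)) := by
      rw [← Finset.sum_sub_distrib]
      refine Finset.sum_congr rfl fun j _ => ?_
      rw [finePt_add_uvec, telescope_uvec]
    -- Cauchy–Schwarz
    have hCS := sq_sum_sum_le (Finset.univ : Finset (Fin (d + 1) → Fin n)) (Finset.range n)
      (fun j t => h (finePt n y j + (t : ℤ) • uvec μ + uvec μ) - h (finePt n y j + (t : ℤ) • uvec μ))
    rw [Finset.card_univ, Fintype.card_fun, Fintype.card_fin, Fintype.card_fin, Finset.card_range] at hCS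
    push_cast at hCS
    -- each inner sum is a sum over distinct fine bonds near `y`
    have hinner : ∀ t ∈ Finset.range n,
        ∑ j : Fin (d + 1) → Fin n,
            (h (finePt n y j + (t : ℤ) • uvec μ + uvec μ) - h (finePt n y j + (t : ℤ) • uvec μ)) ^ 2 ≤ S := by
      intro t ht
      have ht' : t < n := Finset.mem_range.1 ht
      have hinj : Set.InjOn (fun j : Fin (d + 1) → Fin n => finePt n y j + (t : ℤ) • uvec μ)
          ↑(Finset.univ : Finset (Fin (d + 1) → Fin n)) := by
        intro j _ j' _ hjj
        exact finePt_injective n y (add_right_cancel hjj)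
      have hsub : Finset.univ.image (fun j : Fin (d + 1) → Fin n => finePt n y j + (t : ℤ) • uvec μ)
          ⊆ (bset (fineDom n Ω) μ).filter (fun z => NearBlk n μ y z) := by
        intro z hz
        obtain ⟨j, _, rfl⟩ := Finset.mem_image.1 hz
        obtain ⟨h1, h2⟩ := pathPt_factsR hn hyM hy' j ht'
        exact Finset.mem_filter.2 ⟨h1, h2⟩
      calc ∑ j : Fin (d + 1) → Fin n,
            (h (finePt n y j + (t : ℤ) • uvec μ + uvec μ) - h (finePt n y j + (t : ℤ) • uvec μ)) ^ 2
          = ∑ z ∈ Finset.univ.image (fun j : Fin (d + 1) → Fin n => finePt n y j + (t : ℤ) • uvec μ),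
              (h (z + uvec μ) - h z) ^ 2 := by
            rw [Finset.sum_image hinj]
        _ ≤ S := Finset.sum_le_sum_of_subset_of_nonneg hsub fun _ _ _ => sq_nonneg _
    have hsumt : ∑ j : Fin (d + 1) → Fin n, ∑ t ∈ Finset.range n,
        (h (finePt n y j + (t : ℤ) • uvec μ + uvec μ) - h (finePt n y j + (t : ℤ) • uvec μ)) ^ 2 ≤ n * S := by
      rw [Finset.sum_comm]
      calc ∑ t ∈ Finset.range n, ∑ j : Fin (d + 1) → Fin n,
            (h (finePt n y j + (t : ℤ) • uvec μ + uvec μ) - h (finePt n y j + (t : ℤ) • uvec μ)) ^ 2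
          ≤ ∑ _t ∈ Finset.range n, S := Finset.sum_le_sum hinner
        _ = n * S := by rw [Finset.sum_const, Finset.card_range, nsmul_eq_mul]
    rw [hdiff]
    calc (∑ j : Fin (d + 1) → Fin n, ∑ t ∈ Finset.range n,
          (h (finePt n y j + (t : ℤ) • uvec μ + uvec μ) - h (finePt n y j + (t : ℤ) • uvec μ))) ^ 2
        ≤ (n : ℝ) ^ (d + 1) * n * ∑ j : Fin (d + 1) → Fin n, ∑ t ∈ Finset.range n,
            (h (finePt n y j + (t : ℤ) • uvec μ + uvec μ) - h (finePt n y j + (t : ℤ) • uvec μ)) ^ 2 := hCS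
      _ ≤ (n : ℝ) ^ (d + 1) * n * (n * S) := mul_le_mul_of_nonneg_left hsumt (by positivity)
      _ = (n : ℝ) ^ (d + 3) * S := by ring
  -- assemble: sum over unit bonds, exchange, count overlaps
  unfold dirS
  rw [Finset.mul_sum]
  refine Finset.sum_le_sum fun μ _ => ?_
  calc ∑ y ∈ bset Ω μ,
        ((∑ j : Fin (d + 1) → Fin n, h (finePt n (y + uvec μ) j)) - ∑ j : Fin (d + 1) → Fin n, h (finePt n y j)) ^ 2
      ≤ ∑ y ∈ bset Ω μ, (n : ℝ) ^ (d + 3) *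
          ∑ z ∈ (bset (fineDom n Ω) μ).filter (fun z => NearBlk n μ y z), (h (z + uvec μ) - h z) ^ 2 :=
        Finset.sum_le_sum (hbond μ)
    _ = (n : ℝ) ^ (d + 3) * ∑ z ∈ bset (fineDom n Ω) μ,
          (((bset Ω μ).filter (fun y => NearBlk n μ y z)).card : ℝ) * (h (z + uvec μ) - h z) ^ 2 := by
        rw [← Finset.mul_sum]
        congr 1
        simp only [Finset.sum_filter]
        rw [Finset.sum_comm]
        refine Finset.sum_congr rfl fun z _ => ?_
        rw [← Finset.sum_filter, Finset.sum_const, nsmul_eq_mul]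
    _ ≤ (n : ℝ) ^ (d + 3) * ∑ z ∈ bset (fineDom n Ω) μ, 2 * (h (z + uvec μ) - h z) ^ 2 := by
        refine mul_le_mul_of_nonneg_left (Finset.sum_le_sum fun z _ => ?_) (by positivity)
        refine mul_le_mul_of_nonneg_right ?_ (sq_nonneg _)
        exact_mod_cast card_filter_nearBlk_le n μ (bset Ω μ) z
    _ = 2 * (n : ℝ) ^ (d + 3) * ∑ z ∈ bset (fineDom n Ω) μ, (h (z + uvec μ) - h z) ^ 2 := by
        rw [← Finset.mul_sum]
        ring

/-- **THE BLOCK-AVERAGE BOND FORM IS CONTROLLED BY THE FINE BOND FORM**: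
`E_{Ω^{(k)}}(Q_k g) ≤ (2n²/N)·Σ_xΣ_{x′ ∼ x}(g x − g x′)²` (`Q_k = N⁻¹·indR`, `N = n^{d+1}`), for every finite `Ω^{(k)}`.
[folklore] -/
theorem dirS_blockAvg_le {n : ℕ} (hn : 1 ≤ n) (Ω : Finset (Fin (d + 1) → ℤ)) (g : ↥(fineDom n Ω) → ℝ) :
    dirS Ω (extS Ω ((((n : ℝ) ^ (d + 1))⁻¹) • (indR n Ω).mulVec g))
      ≤ 2 * (n : ℝ) ^ 2 * ((n : ℝ) ^ (d + 1))⁻¹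
        * ∑ x : ↥(fineDom n Ω), ∑ x' : ↥(fineDom n Ω), if x'.1 ∈ nbrs x.1 then (g x - g x') ^ 2 else 0 := by
  have hn0 : (0 : ℝ) < n := by exact_mod_cast hn
  rw [extS_smul, dirS_smul]
  have hcongr : dirS Ω (extS Ω ((indR n Ω).mulVec g))
      = dirS Ω (fun y => ∑ j : Fin (d + 1) → Fin n, extS (fineDom n Ω) g (finePt n y j)) := by
    refine dirS_congr fun y hy => ?_
    rw [extS_of_mem _ hy, indR_mulVec_eq_chartSum hn Ω g ⟨y, hy⟩]
  rw [hcongr]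
  have h1 := dirS_blockSum_le hn Ω (extS (fineDom n Ω) g)
  have h2 := dirS_extS_le_pairSum (S := fineDom n Ω) g
  have h12 : dirS Ω (fun y => ∑ j : Fin (d + 1) → Fin n, extS (fineDom n Ω) g (finePt n y j))
      ≤ 2 * (n : ℝ) ^ (d + 3)
        * ∑ x : ↥(fineDom n Ω), ∑ x' : ↥(fineDom n Ω), if x'.1 ∈ nbrs x.1 then (g x - g x') ^ 2 else 0 :=
    h1.trans (mul_le_mul_of_nonneg_left h2 (by positivity))
  have hN : (n : ℝ) ^ (d + 1) ≠ 0 := by positivity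
  calc (((n : ℝ) ^ (d + 1))⁻¹) ^ 2
        * dirS Ω (fun y => ∑ j : Fin (d + 1) → Fin n, extS (fineDom n Ω) g (finePt n y j))
      ≤ (((n : ℝ) ^ (d + 1))⁻¹) ^ 2 * (2 * (n : ℝ) ^ (d + 3)
        * ∑ x : ↥(fineDom n Ω), ∑ x' : ↥(fineDom n Ω), if x'.1 ∈ nbrs x.1 then (g x - g x') ^ 2 else 0) :=
        mul_le_mul_of_nonneg_left h12 (by positivity)
    _ = 2 * (n : ℝ) ^ 2 * ((n : ℝ) ^ (d + 1))⁻¹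
        * ∑ x : ↥(fineDom n Ω), ∑ x' : ↥(fineDom n Ω), if x'.1 ∈ nbrs x.1 then (g x - g x') ^ 2 else 0 := by
        have h3 : (n : ℝ) ^ (d + 3) = (n : ℝ) ^ (d + 1) * (n : ℝ) ^ 2 := by ring
        rw [h3]
        field_simp

/-! ## §5  The lower bound (1.22) at `A = 0`: coercivity of `Δ^{(k)}(Ω, 0)` by the unit bond form AND the mass term -/

/-- **(1.22) AT `A = 0`, EXPLICIT CONSTANT, EVERY FINITE `Ω^{(k)}`** (Bałaban's «Proposition 3.1′ of [2]» in the case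
`U ≡ 1`, where (1.21) is void and the `O(1)e^{2−α}` term is absent): for every mesh `η = 1/n`, every finite
`Ω^{(k)} ⊂ ℤ^{d+1}`, `a_k > 0`, `m² ≥ 0` and every `φ : Ω^{(k)} → ℝ`,
`⟨φ, Δ^{(k)}(Ω,0)φ⟩ ≥ min(a_k/(8(d+1) + 2m²), 1/8)·(Σ_{⟨y,y′⟩⊂Ω^{(k)}}(φ(y′) − φ(y))² + m²Σ_{y∈Ω^{(k)}}φ(y)²)`.
Proof: the energy identity `F = aA + N⁻¹B` (`KeffR_form_eq_energy`), `B = (n²/2)U + m²‖g⋆‖²` (`fineEnergyR_eq`),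
`E(φ) ≤ 2E(φ − Q_kg⋆) + 2E(Q_kg⋆) ≤ 8(d+1)A + 8N⁻¹(n²/2)U` (`dirS_extS_le_norm`, `dirS_blockAvg_le`) and
`m²‖φ‖² ≤ 2m²A + 2m²‖Q_kg⋆‖² ≤ 2m²A + 2m²N⁻¹‖g⋆‖²` (`blockAvg_sq_le`).
[cite: Balaban1983RegularityDecay, p. 574 (1.22), case A = 0 (constant and proof the package's)] -/
theorem KeffR_form_ge {n : ℕ} (hn : 1 ≤ n) {a m2 : ℝ} (ha : 0 < a) (hm : 0 ≤ m2)
    (Ω : Finset (Fin (d + 1) → ℤ)) (ψ : ↥Ω → ℝ) :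
    min (a / (8 * (d + 1) + 2 * m2)) (1 / 8) * (dirS Ω (extS Ω ψ) + m2 * (ψ ⬝ᵥ ψ))
      ≤ ψ ⬝ᵥ (KeffR n a m2 Ω).mulVec ψ := by
  have hn0 : (0 : ℝ) < n := by exact_mod_cast hn
  set N : ℝ := (n : ℝ) ^ (d + 1) with hNdef
  have hN0 : 0 < N := by positivity
  set g := gStarR n a m2 Ω ψ with hg
  set w := (indR n Ω).mulVec g with hw
  set Q : ↥Ω → ℝ := N⁻¹ • w with hQ
  set A : ℝ := ∑ y, (ψ y - N⁻¹ * w y) ^ 2 with hA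
  set B : ℝ := g ⬝ᵥ (fineOpR n a m2 (fineDom n Ω)).mulVec g - a * N⁻¹ * ∑ y, w y ^ 2 with hB
  set U : ℝ := ∑ x : ↥(fineDom n Ω), ∑ x' : ↥(fineDom n Ω), if x'.1 ∈ nbrs x.1 then (g x - g x') ^ 2 else 0
    with hU
  have hF : ψ ⬝ᵥ (KeffR n a m2 Ω).mulVec ψ = a * A + N⁻¹ * B := KeffR_form_eq_energy hn ha hm Ω ψ
  have hA0 : 0 ≤ A := Finset.sum_nonneg fun _ _ => sq_nonneg _
  have hU0 : 0 ≤ U :=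
    Finset.sum_nonneg fun _ _ => Finset.sum_nonneg fun _ _ => by split_ifs <;> positivity
  have hgg : 0 ≤ g ⬝ᵥ g := Finset.sum_nonneg fun x _ => mul_self_nonneg (g x)
  have hBeq : B = (n : ℝ) ^ 2 / 2 * U + m2 * (g ⬝ᵥ g) := fineEnergyR_eq hn a m2 Ω g
  -- the bond form: split ψ = (ψ − Q) + Q
  have hsplit : extS Ω ψ = extS Ω (ψ - Q) + extS Ω Q := by
    rw [← extS_add, sub_add_cancel]
  have hAA : (ψ - Q) ⬝ᵥ (ψ - Q) = A := by
    rw [hA]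
    unfold dotProduct
    refine Finset.sum_congr rfl fun y _ => ?_
    simp only [hQ, Pi.sub_apply, Pi.smul_apply, smul_eq_mul]
    ring
  have hE1 : dirS Ω (extS Ω (ψ - Q)) ≤ 4 * (d + 1) * A := by
    have h := dirS_extS_le_norm (ψ - Q)
    rw [hAA] at h
    exact h
  have hE2 : dirS Ω (extS Ω Q) ≤ 4 * N⁻¹ * ((n : ℝ) ^ 2 / 2 * U) := by
    have h := dirS_blockAvg_le hn Ω g
    calc dirS Ω (extS Ω Q) ≤ 2 * (n : ℝ) ^ 2 * N⁻¹ * U := h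
      _ = 4 * N⁻¹ * ((n : ℝ) ^ 2 / 2 * U) := by ring
  have hE : dirS Ω (extS Ω ψ) ≤ 8 * (d + 1) * A + 8 * N⁻¹ * ((n : ℝ) ^ 2 / 2 * U) := by
    rw [hsplit]
    have := dirS_add_le Ω (extS Ω (ψ - Q)) (extS Ω Q)
    linarith
  -- the mass term: ψ_y² ≤ 2(ψ_y − Q_y)² + 2Q_y², and Jensen on blocks
  have hQQ : Q ⬝ᵥ Q ≤ N⁻¹ * (g ⬝ᵥ g) := by
    have h := blockAvg_sq_le hn Ω g
    have e : Q ⬝ᵥ Q = ∑ y : ↥Ω, (N⁻¹ * (indR n Ω).mulVec g y) ^ 2 := by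
      unfold dotProduct
      refine Finset.sum_congr rfl fun y _ => ?_
      simp only [hQ, hw, Pi.smul_apply, smul_eq_mul]
      ring
    rw [e]
    exact h
  have hS : ψ ⬝ᵥ ψ ≤ 2 * A + 2 * (Q ⬝ᵥ Q) := by
    rw [← hAA]
    unfold dotProduct
    rw [Finset.mul_sum, Finset.mul_sum, ← Finset.sum_add_distrib]
    refine Finset.sum_le_sum fun y _ => ?_
    simp only [Pi.sub_apply]
    nlinarith [sq_nonneg (ψ y - 2 * Q y)]
  have hM : m2 * (ψ ⬝ᵥ ψ) ≤ 2 * m2 * A + 2 * N⁻¹ * (m2 * (g ⬝ᵥ g)) := by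
    have h1 : m2 * (ψ ⬝ᵥ ψ) ≤ m2 * (2 * A + 2 * (Q ⬝ᵥ Q)) := mul_le_mul_of_nonneg_left hS hm
    have h2 : m2 * (Q ⬝ᵥ Q) ≤ m2 * (N⁻¹ * (g ⬝ᵥ g)) := mul_le_mul_of_nonneg_left hQQ hm
    linarith
  -- total
  have hT : dirS Ω (extS Ω ψ) + m2 * (ψ ⬝ᵥ ψ) ≤ (8 * (d + 1) + 2 * m2) * A + 8 * N⁻¹ * B := by
    have h3 : 0 ≤ N⁻¹ * (m2 * (g ⬝ᵥ g)) := mul_nonneg (inv_nonneg.2 hN0.le) (mul_nonneg hm hgg)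
    rw [hBeq]
    nlinarith
  -- compare constants
  set c : ℝ := min (a / (8 * (d + 1) + 2 * m2)) (1 / 8) with hc
  have hden : (0 : ℝ) < 8 * (d + 1) + 2 * m2 := by positivity
  have hc0 : 0 ≤ c := le_min (div_nonneg ha.le hden.le) (by norm_num)
  have hc1 : c * (8 * (d + 1) + 2 * m2) ≤ a := by
    have : c ≤ a / (8 * (d + 1) + 2 * m2) := min_le_left _ _
    calc c * (8 * (d + 1) + 2 * m2) ≤ a / (8 * (d + 1) + 2 * m2) * (8 * (d + 1) + 2 * m2) :=
        mul_le_mul_of_nonneg_right this hden.le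
      _ = a := div_mul_cancel₀ a hden.ne'
  have hc2 : c * 8 ≤ 1 := by
    have : c ≤ 1 / 8 := min_le_right _ _
    linarith
  have hB0 : 0 ≤ B := by
    rw [hBeq]
    have : 0 ≤ m2 * (g ⬝ᵥ g) := mul_nonneg hm hgg
    positivity
  rw [hF]
  calc c * (dirS Ω (extS Ω ψ) + m2 * (ψ ⬝ᵥ ψ)) ≤ c * ((8 * (d + 1) + 2 * m2) * A + 8 * N⁻¹ * B) :=
        mul_le_mul_of_nonneg_left hT hc0
    _ = c * (8 * (d + 1) + 2 * m2) * A + c * 8 * (N⁻¹ * B) := by ring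
    _ ≤ a * A + 1 * (N⁻¹ * B) := by
        gcongr
    _ = a * A + N⁻¹ * B := by ring

/-- **UPPER BOUND** `⟨φ, Δ^{(k)}(Ω,0)φ⟩ ≤ a_k‖φ‖²` (the Green form is nonnegative). [folklore] -/
theorem KeffR_form_le {n : ℕ} (hn : 1 ≤ n) {a m2 : ℝ} (ha : 0 < a) (hm : 0 ≤ m2)
    (Ω : Finset (Fin (d + 1) → ℤ)) (ψ : ↥Ω → ℝ) : ψ ⬝ᵥ (KeffR n a m2 Ω).mulVec ψ ≤ a * (ψ ⬝ᵥ ψ) := by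
  rw [KeffR_form_eq]
  set φ := (indR n Ω)ᵀ.mulVec ψ with hφ
  set u := ((fineOpR n a m2 (fineDom n Ω))⁻¹).mulVec φ with hu
  have hTu : (fineOpR n a m2 (fineDom n Ω)).mulVec u = φ := by
    rw [hu, Matrix.mulVec_mulVec, fineOpR_mul_inv_fineDom hn ha hm Ω, Matrix.one_mulVec]
  have hpos : 0 ≤ φ ⬝ᵥ u := by
    have h := lower18 hn ha.le m2 (fineDom_isBlockUnion hn Ω) u
    have h0 : 0 ≤ (min 2 a + m2) * (u ⬝ᵥ u) :=
      mul_nonneg (add_pos_of_pos_of_nonneg (lt_min two_pos ha) hm).le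
        (Finset.sum_nonneg fun x _ => mul_self_nonneg (u x))
    calc (0 : ℝ) ≤ u ⬝ᵥ (fineOpR n a m2 (fineDom n Ω)).mulVec u := h0.trans h
      _ = φ ⬝ᵥ u := by rw [hTu, dotProduct_comm]
  have : 0 ≤ a ^ 2 * ((n : ℝ) ^ (d + 1))⁻¹ * (φ ⬝ᵥ u) := mul_nonneg (by positivity) hpos
  linarith

/-- **(1.22) AT `A = 0` IN THE PRINTED QUANTIFIER ORDER** — «there exists a positive constant γ₀ … such that …
(1.22) … independent of Ω, k, A, and for an arbitrary function φ»: for a parameter window `a_k ≥ a₋ > 0`,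
`0 ≤ m² ≤ m²₊` ONE constant `γ₀ = min(a₋/(8(d+1) + 2m²₊), 1/8)` serves every mesh `η = 1/n` (every `k`), every finite
`Ω^{(k)} ⊂ ℤ^{d+1}` and every `φ`, with NO `O(1)e^{2−α}` correction (there is no gauge field). The dependence of `γ₀`
on the window (not «on d only») is the package's, cf. the printed proof's own «if m² ≤ O(1)» at (4.4) p. 589 and
`B4.prop31_gamma0`. [cite: Balaban1983RegularityDecay, p. 574 (1.21)–(1.22), case A = 0 (constant and proof the package's)] -/
theorem ineq122_A0 (d : ℕ) {amin m2max : ℝ} (hamin : 0 < amin) (hmax : 0 ≤ m2max) :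
    ∃ γ₀ : ℝ, 0 < γ₀ ∧ ∀ (n : ℕ), 1 ≤ n → ∀ (a m2 : ℝ), amin ≤ a → 0 ≤ m2 → m2 ≤ m2max →
      ∀ (Ω : Finset (Fin (d + 1) → ℤ)) (ψ : ↥Ω → ℝ),
        γ₀ * (dirS Ω (extS Ω ψ) + m2 * (ψ ⬝ᵥ ψ)) ≤ ψ ⬝ᵥ (KeffR n a m2 Ω).mulVec ψ := by
  refine ⟨min (amin / (8 * (d + 1) + 2 * m2max)) (1 / 8), lt_min (by positivity) (by norm_num), ?_⟩
  intro n hn a m2 ha hm hmB Ω ψ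
  have ha0 : 0 < a := lt_of_lt_of_le hamin ha
  have hle : min (amin / (8 * (d + 1) + 2 * m2max)) (1 / 8) ≤ min (a / (8 * (d + 1) + 2 * m2)) (1 / 8) := by
    refine min_le_min ?_ le_rfl
    have hd1 : (0 : ℝ) < 8 * (d + 1) + 2 * m2 := by positivity
    have hd2 : (0 : ℝ) < 8 * (d + 1) + 2 * m2max := by positivity
    calc amin / (8 * (d + 1) + 2 * m2max) ≤ amin / (8 * (d + 1) + 2 * m2) :=
        div_le_div_of_nonneg_left hamin.le hd1 (by linarith)
      _ ≤ a / (8 * (d + 1) + 2 * m2) := div_le_div_of_nonneg_right ha hd1.le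
  have hX : 0 ≤ dirS Ω (extS Ω ψ) + m2 * (ψ ⬝ᵥ ψ) :=
    add_nonneg (dirS_nonneg _ _) (mul_nonneg hm (Finset.sum_nonneg fun y _ => mul_self_nonneg (ψ y)))
  exact (mul_le_mul_of_nonneg_right hle hX).trans (KeffR_form_ge hn ha0 hm Ω ψ)

/-! ## §6  The DAG leaf: `B4.Prop31Printed` for the concrete ZERO-FIELD carriers -/

/-- **INDEX OF THE ZERO-FIELD INSTANCES** of «Proposition 3.1′ of [2]» over the parameter window `a_k ≥ a₋`,
`0 ≤ m² ≤ m²₊`: a mesh `n ≥ 1` (`η = 1/n = L^{-k}`; field `hn`), a finite `Ω^{(k)} ⊂ ℤ^{d+1}` (field `Ω`), the constants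
`a = a_k` of (1.14) (`ha : a₋ ≤ a`) and `m2 = m²` of (1.6) (`hm : 0 ≤ m2`, `hmB : m2 ≤ m²₊`), the charge `e` of (1.2)
(which does not enter the operators at `A = 0`), and the number `N` of real components of the field `φ : Ω^{(k)} → ℝ^N`
(at `U ≡ 1` every operator of (1.3)–(1.6), (1.14) acts componentwise; a `ℂ^N`- or Lie-algebra-valued field is a real
field with more components). [folklore] -/
structure ZeroIdx (d : ℕ) (amin m2max : ℝ) where
  n : ℕ
  hn : 1 ≤ n
  Ω : Finset (Fin (d + 1) → ℤ)
  a : ℝ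
  ha : amin ≤ a
  m2 : ℝ
  hm : 0 ≤ m2
  hmB : m2 ≤ m2max
  e : ℝ
  N : ℕ

/-- **THE ZERO-FIELD CARRIERS OF `B4.FormSetting`**: `Cfg = (Ω^{(k)} → ℝ^N)`; `form φ = Σ_c ⟨φ_c, Δ^{(k)}(Ω,0)φ_c⟩`
(`KeffR`); `covDiffSq φ = Σ_{⟨y,y′⟩⊂Ω^{(k)}}|φ(y′) − φ(y)|²` (`U ≡ 1`; `dirS` summed over components); `l2sq φ =
Σ_{y∈Ω^{(k)}}|φ(y)|²`; `massSq = m²`; `unitBlocks := True` (the fine region IS the union `fineDom n Ω` of the unit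
blocks over `Ω^{(k)}`, so «Let Ω be a sum of unit blocks» holds by construction); `reg121 := True` ((1.21) at `A = 0` reads
`0 ≤ O(1)p(e)`). [cite: Balaban1983RegularityDecay, p. 574 (1.21)–(1.22), dictionary at A = 0] [folklore] -/
def zeroFieldForms (d : ℕ) (amin m2max : ℝ) (i : ZeroIdx d amin m2max) : B4.FormSetting where
  Cfg := ↥i.Ω → Fin i.N → ℝ
  e := i.e
  massSq := i.m2
  unitBlocks := True
  reg121 := True
  form := fun φ => ∑ c : Fin i.N, (fun y => φ y c) ⬝ᵥ (KeffR i.n i.a i.m2 i.Ω).mulVec (fun y => φ y c)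
  covDiffSq := fun φ => ∑ c : Fin i.N, dirS i.Ω (extS i.Ω (fun y => φ y c))
  l2sq := fun φ => ∑ c : Fin i.N, (fun y => φ y c) ⬝ᵥ (fun y => φ y c)

/-- **LEAF `b4`, CONJUNCT 3, FOR THE ZERO-FIELD CARRIERS**: `B4.Prop31Printed (zeroFieldForms d a₋ m²₊)` — the
verbatim-typed «Proposition 3.1′ of [2]» (1.21)–(1.22) (`B4.Prop31Printed`, surge node T01.3) HOLDS for the family
of all its `A = 0` instances in the window `a_k ≥ a₋ > 0`, `0 ≤ m² ≤ m²₊`, with `γ₀ = min(a₋/(8(d+1) + 2m²₊), 1/8)`,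
threshold `e₁ = 1` (vacuous) and error constant `C(α) = 0` for every `α > 0`. Nothing is claimed about `A ≠ 0`.
[cite: Balaban1983RegularityDecay, Prop. 3.1′ of [2] (1.21)–(1.22) p.574, case A = 0 (constant and proof the package's)] -/
theorem prop31Printed_zeroField (d : ℕ) {amin m2max : ℝ} (hamin : 0 < amin) (hmax : 0 ≤ m2max) :
    B4.Prop31Printed (zeroFieldForms d amin m2max) := by
  obtain ⟨γ₀, hγ, H⟩ := ineq122_A0 d hamin hmax
  refine ⟨γ₀, 1, hγ, one_pos, fun α _ => ⟨0, le_rfl, fun i _ _ _ _ φ => ?_⟩⟩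
  have h := fun c : Fin i.N => H i.n i.hn i.a i.m2 i.ha i.hm i.hmB i.Ω (fun y => φ y c)
  simp only [zeroFieldForms, zero_mul, sub_zero]
  rw [Finset.mul_sum, mul_add, Finset.mul_sum, Finset.mul_sum, ← Finset.sum_add_distrib]
  refine Finset.sum_le_sum fun c _ => ?_
  have := h c
  linarith

end

end Literature.MathematicalPhysics.QuantumFieldTheory.Balaban1983to89.B4Prop31Zero
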